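import Mathlib.LinearAlgebra.Matrix.PosDef
import Mathlib.Analysis.Matrix.Order
import Mathlib.Data.Nat.Factorization.Basic
import Mathlib.Analysis.SpecialFunctions.Pow.Real
import Mathlib.Algebra.Order.Star.Real
import Mathlib.Data.ZMod.Basic
import Mathlib.GroupTheory.OrderOfElement
import Mathlib.Data.Nat.PrimeFin
import HarnessLib

/-!
# Bost–Connes system: the KMS_β Gram forms on the finite levels `ℚ[ℤ/nℤ]`

For `0 < β ≤ 1` the Bost–Connes system `(C*(ℚ/ℤ) ⋊ ℕ^×, σ_t)` has a unique KMS_β state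
`φ_β` ([BostConnes1995]; [ConnesMarcolli2008] Ch. 3, Thm. 3.32), whose values on the group-like
basis elements `e(r)`, `r ∈ ℚ/ℤ`, of the rational subalgebra are
([ConnesMarcolli2008] (3.133), written out as (3.138), p. 475):

  `φ_β(e(a/b)) = b^{-β} ∏_{p prime, p ∣ b} (1 - p^{β-1}) / (1 - p^{-1})`,  `gcd(a, b) = 1`,

a function of the order `b` of `a/b` in `ℚ/ℤ` only. On the finite level `A_n = ℚ[ℤ/nℤ]`
([ConnesMarcolli2008] Thm. 4.38) the state induces the Hermitian form
`⟨x, y⟩_β = φ_β(x* y)`, whose Gram matrix in the basis `e(j/n)` is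
`G_β[i, j] = φ_β(e((j - i)/n))`.

This file vendors the printed formula as a definition and PROVES the finite-level content of
"`φ_β` is a state" in the case a finite computation meets first:

* `kmsValue β b` = the right-hand side of (3.138); `kmsGram β n` = the level-`n` Gram matrix;
* sanity values: `kmsValue β 1 = 1` (normalisation `φ_β(1) = 1`), `kmsGram 0 n` = the all-ones
  matrix, `kmsGram 1 n = 1` (at `β = 1`, `φ_1(e(r)) = 0` for `r ≠ 0`: the canonical trace);
* `posSemidef_kmsGram_primePow`: for every prime power level `n = p^m` and every
  `0 ≤ β ≤ 1` the Gram matrix `G_β` is positive semidefinite. The proof is the finite-level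
  mechanism behind positivity: on `ℤ/p^m ℤ` the function `γ ↦ φ_β(e(γ))` is the non-negative
  combination `∑_{0 ≤ i ≤ m} A_i · 1[p^{m-i} γ = 0]` of indicator functions of the subgroups
  `p^i ℤ/p^m ℤ` (`A_i ≥ 0` exactly because `0 ≤ β ≤ 1`), and each such indicator gives the
  Gram matrix `Bᵀ B` of the "same coset" relation.
* `posSemidef_kmsGram`: the same for EVERY level `n ≥ 1` (appended 2026-08-20): (3.138) is
  multiplicative in the order (`kmsValue_eq_prod_primeFactors`), so `G_β` is the entrywise
  product over `p ∣ n` of `p`-local factors, each a non-negative combination of the indicator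
  Grams `1[(n/p^i)(y - x) = 0]`; Schur's product theorem (`Matrix.PosSemidef.hadamard`)
  finishes.

What is NOT here: positivity for `β > 1` (there the extremal KMS states are the Gibbs states
(3.139) and positivity is termwise), definiteness (rank) statements, uniqueness / the KMS
condition itself, and the type III₁ analysis of [BostConnes1995]. No named facts are
introduced.

## Sources (read at the page)

* [ConnesMarcolli2008] A. Connes, M. Marcolli, *Noncommutative Geometry, Quantum Fields and
  Motives*, AMS Colloq. Publ. 55 (2008), Ch. 3 §4.6, Thm. 3.32 and eq. (3.133) (p. 474),
  eq. (3.138) (p. 475); Ch. 4 Thm. 4.38 (p. 608: `A_n = ℚ[ℤ/nℤ]`, basis `e(j/n)`).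
* [BostConnes1995] J.-B. Bost, A. Connes, Selecta Math. (N.S.) 1 (1995) 411–457, Thm. 5
  (KMS classification; the source of Thm. 3.32).
-/

noncomputable section

open Finset
open scoped Matrix

namespace Literature.NumberTheory.BostConnes

/-! ## The printed state formula and the level-`n` Gram matrix -/

/-- **Values of the Bost–Connes KMS_β state, `0 < β ≤ 1`** ([ConnesMarcolli2008] (3.138)): for
`r = a/b ∈ ℚ/ℤ` in lowest terms (so `b` is the order of `r`),
`φ_β(e(a/b)) = b^{-β} ∏_{p prime, p ∣ b} (1 - p^{β-1})/(1 - p^{-1})`, as a function of `b`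
(defined for every real `β`; it is the KMS_β value for `0 < β ≤ 1`).
[cite: ConnesMarcolli2008, Ch. 3 Thm. 3.32, eq. (3.138)] -/
def kmsValue (β : ℝ) (b : ℕ) : ℝ :=
  (b : ℝ) ^ (-β) * ∏ p ∈ b.primeFactors, (1 - (p : ℝ) ^ (β - 1)) / (1 - (p : ℝ)⁻¹)

/-- **Gram matrix of the KMS_β form on the level `A_n = ℚ[ℤ/nℤ]`** in the basis `e(j/n)`,
`j ∈ ℤ/nℤ`: `G_β[i, j] = φ_β(e(i/n)* e(j/n)) = φ_β(e((j-i)/n))`, and `(j-i)/n ∈ ℚ/ℤ` has order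
the additive order of `j - i ∈ ℤ/nℤ`.
[cite: ConnesMarcolli2008, Ch. 3 Thm. 3.32, eq. (3.138); Ch. 4 Thm. 4.38] -/
def kmsGram (β : ℝ) (n : ℕ) : Matrix (ZMod n) (ZMod n) ℝ :=
  Matrix.of fun i j => kmsValue β (addOrderOf (j - i))

/-- Entries of `kmsGram`. [cite: ConnesMarcolli2008, eq. (3.138)] -/
@[simp] theorem kmsGram_apply (β : ℝ) (n : ℕ) (i j : ZMod n) :
    kmsGram β n i j = kmsValue β (addOrderOf (j - i)) := rfl

/-- Normalisation `φ_β(e(0)) = φ_β(1) = 1`: the value at order `b = 1`.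
[cite: ConnesMarcolli2008, Ch. 3 Thm. 3.32, eq. (3.138)] -/
@[simp] theorem kmsValue_one (β : ℝ) : kmsValue β 1 = 1 := by
  simp [kmsValue]

/-- At `β = 0` every value is `1` (`b^0 · ∏ (1 - p^{-1})/(1 - p^{-1})`): the form `G_0` is the
all-ones matrix (rank one). [cite: ConnesMarcolli2008, eq. (3.138)] -/
theorem kmsValue_zero_beta (b : ℕ) : kmsValue 0 b = 1 := by
  unfold kmsValue
  rw [neg_zero, Real.rpow_zero, one_mul]
  refine Finset.prod_eq_one fun p hp => ?_
  have hp1 : (1 : ℝ) < p := by exact_mod_cast (Nat.prime_of_mem_primeFactors hp).one_lt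
  rw [zero_sub, Real.rpow_neg_one]
  exact div_self (sub_ne_zero.2 (inv_lt_one_of_one_lt₀ hp1).ne')

/-- At `β = 1`, `φ_1(e(a/b)) = 0` for every order `b > 1` (the factor `1 - p^0` vanishes for a
prime `p ∣ b`): `φ_1` is the canonical trace of `ℚ[ℚ/ℤ]` ((3.133) with `f_0(b) = ∑_{d∣b} μ(d)`).
[cite: ConnesMarcolli2008, Ch. 3 Thm. 3.32, eqs. (3.133), (3.138)] -/
theorem kmsValue_one_beta {b : ℕ} (hb : 1 < b) : kmsValue 1 b = 0 := by
  unfold kmsValue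
  obtain ⟨p, hp, hpb⟩ := Nat.exists_prime_and_dvd hb.ne'
  have hmem : p ∈ b.primeFactors :=
    Nat.mem_primeFactors.2 ⟨hp, hpb, by omega⟩
  rw [Finset.prod_eq_zero hmem (by simp), mul_zero]

/-- Hence the level-`n` Gram matrix at `β = 1` is the identity (the basis `e(j/n)` is
orthonormal for the trace), for every `n ≥ 1`. [cite: ConnesMarcolli2008, eqs. (3.133), (3.138)] -/
theorem kmsGram_one_beta (n : ℕ) [NeZero n] : kmsGram 1 n = 1 := by
  ext i j
  rw [kmsGram_apply, Matrix.one_apply]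
  by_cases h : i = j
  · subst h
    simp
  · have hne : j - i ≠ 0 := sub_ne_zero.2 (Ne.symm h)
    have hord : 1 < addOrderOf (j - i) := by
      have hpos : 0 < addOrderOf (j - i) := addOrderOf_pos (j - i)
      have hne1 : addOrderOf (j - i) ≠ 1 := by
        rwa [Ne, AddMonoid.addOrderOf_eq_one_iff]
      omega
    rw [kmsValue_one_beta hord, if_neg h]

/-- And at `β = 0` the Gram matrix is the all-ones matrix. [cite: ConnesMarcolli2008, eq. (3.138)] -/
theorem kmsGram_zero_beta (n : ℕ) : kmsGram 0 n = Matrix.of fun _ _ => (1 : ℝ) := by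
  ext i j
  rw [kmsGram_apply, kmsValue_zero_beta, Matrix.of_apply]

/-- `G_β` is symmetric: `ord(-(γ)) = ord(γ)`. [cite: ConnesMarcolli2008, eq. (3.138)] -/
theorem kmsGram_isHermitian (β : ℝ) (n : ℕ) : (kmsGram β n).IsHermitian := by
  ext i j
  simp only [Matrix.conjTranspose_apply, kmsGram_apply, star_trivial]
  rw [← neg_sub, addOrderOf_neg]

/-! ## Prime-power levels: `G_β ≥ 0` for `0 ≤ β ≤ 1` -/

section PrimePow

variable {p : ℕ} [hp : Fact p.Prime]

/-- The value of (3.138) at a prime-power order `b = p^e`, `e ≥ 1`: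
`φ_β = (p^e)^{-β} (1 - p^{β-1})/(1 - p^{-1})`. [cite: ConnesMarcolli2008, eq. (3.138)] -/
theorem kmsValue_primePow (β : ℝ) {e : ℕ} (he : e ≠ 0) :
    kmsValue β (p ^ e) =
      ((p : ℝ) ^ e) ^ (-β) * ((1 - (p : ℝ) ^ (β - 1)) / (1 - (p : ℝ)⁻¹)) := by
  unfold kmsValue
  rw [Nat.primeFactors_prime_pow he hp.out, Finset.prod_singleton, Nat.cast_pow]

/-- The `p`-local constant `c_p(β) = (1 - p^{β-1})/(1 - p^{-1})` of (3.138) is `≥ 0` for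
`β ≤ 1`. [cite: ConnesMarcolli2008, eq. (3.138)] -/
private theorem localConst_nonneg {β : ℝ} (h1 : β ≤ 1) :
    0 ≤ (1 - (p : ℝ) ^ (β - 1)) / (1 - (p : ℝ)⁻¹) := by
  have hp1 : (1 : ℝ) < p := by exact_mod_cast hp.out.one_lt
  refine div_nonneg (sub_nonneg.2 ?_) (sub_nonneg.2 (inv_lt_one_of_one_lt₀ hp1).le)
  exact Real.rpow_le_one_of_one_le_of_nonpos hp1.le (by linarith)

/-- `φ_β(e(1/p)) ≤ 1 = φ_β(1)` for `0 ≤ β ≤ 1`: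
`p^{-β}(1 - p^{β-1}) = p^{-β} - p^{-1} ≤ 1 - p^{-1}`. [cite: ConnesMarcolli2008, eq. (3.138)] -/
private theorem kmsValue_prime_le_one {β : ℝ} (h0 : 0 ≤ β) :
    kmsValue β (p ^ 1) ≤ 1 := by
  have hp0 : (0 : ℝ) < p := by exact_mod_cast hp.out.pos
  have hp1 : (1 : ℝ) < p := by exact_mod_cast hp.out.one_lt
  have hden : 0 < 1 - (p : ℝ)⁻¹ := sub_pos.2 (inv_lt_one_of_one_lt₀ hp1)
  rw [kmsValue_primePow β one_ne_zero, pow_one, ← mul_div_assoc, div_le_one hden, mul_sub,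
    mul_one, ← Real.rpow_add hp0, show -β + (β - 1) = (-1 : ℝ) by ring, Real.rpow_neg_one]
  have : (p : ℝ) ^ (-β) ≤ 1 := Real.rpow_le_one_of_one_le_of_nonpos hp1.le (by linarith)
  linarith

/-- The values `w(e) = φ_β` at order `p^e` DECREASE with `e` when `0 ≤ β ≤ 1`.
[cite: ConnesMarcolli2008, eq. (3.138)] -/
private theorem kmsValue_primePow_succ_le {β : ℝ} (h0 : 0 ≤ β) (h1 : β ≤ 1) (e : ℕ) :
    kmsValue β (p ^ (e + 1)) ≤ kmsValue β (p ^ e) := by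
  rcases Nat.eq_zero_or_pos e with rfl | he
  · rw [pow_zero, kmsValue_one, zero_add]
    exact kmsValue_prime_le_one h0
  · have hp1 : (1 : ℝ) < p := by exact_mod_cast hp.out.one_lt
    rw [kmsValue_primePow β (by omega : e + 1 ≠ 0), kmsValue_primePow β he.ne']
    refine mul_le_mul_of_nonneg_right ?_ (localConst_nonneg h1)
    have hpe : (0 : ℝ) < (p : ℝ) ^ e := pow_pos (by linarith) e
    refine Real.rpow_le_rpow_of_nonpos hpe ?_ (by linarith)
    rw [pow_succ]
    exact le_mul_of_one_le_right hpe.le hp1.le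

/-- `φ_β ≥ 0` at every prime-power order (`β ≤ 1`). [cite: ConnesMarcolli2008, eq. (3.138)] -/
private theorem kmsValue_primePow_nonneg {β : ℝ} (h1 : β ≤ 1) (e : ℕ) :
    0 ≤ kmsValue β (p ^ e) := by
  rcases Nat.eq_zero_or_pos e with rfl | he
  · simp
  · rw [kmsValue_primePow β he.ne']
    exact mul_nonneg (Real.rpow_nonneg (pow_nonneg (Nat.cast_nonneg _) _) _)
      (localConst_nonneg h1)

/-- The "same coset of `p^i ℤ/p^m ℤ`" matrix: `B_i[c, x] = 1` iff `p^{m-i} x = c`; then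
`(B_iᵀ B_i)[x, y] = 1[p^{m-i}(y - x) = 0]`. [cite: ConnesMarcolli2008, eq. (3.138)] -/
private def cosetMatrix (m i : ℕ) : Matrix (ZMod (p ^ m)) (ZMod (p ^ m)) ℝ :=
  Matrix.of fun c x => if (p ^ (m - i)) • x = c then 1 else 0

/-- `(B_iᵀ B_i)[x, y] = 1[p^{m-i}(y - x) = 0]`: two elements have the same image under
multiplication by `p^{m-i}` iff their difference is killed by it. [folklore] -/
private theorem conjTranspose_cosetMatrix_mul_self_apply (m i : ℕ) (x y : ZMod (p ^ m)) :
    ((cosetMatrix (p := p) m i)ᴴ * cosetMatrix (p := p) m i) x y =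
      if (p ^ (m - i)) • (y - x) = 0 then 1 else 0 := by
  rw [Matrix.mul_apply]
  simp only [Matrix.conjTranspose_apply, cosetMatrix, Matrix.of_apply, star_trivial,
    ite_mul, one_mul, zero_mul]
  rw [Finset.sum_ite_eq]
  simp only [Finset.mem_univ, if_true, smul_sub, sub_eq_zero]

/-- Every element of `ℤ/p^m ℤ` has additive order `p^e` for some `e ≤ m`. [folklore] -/
private theorem exists_addOrderOf_eq_pow (m : ℕ) (z : ZMod (p ^ m)) :
    ∃ e ≤ m, addOrderOf z = p ^ e := by
  have hdvd : addOrderOf z ∣ p ^ m := by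
    simpa [Nat.card_zmod] using addOrderOf_dvd_natCard z
  exact (Nat.dvd_prime_pow hp.out).1 hdvd

/-- **The KMS_β Gram form on a prime-power level is positive semidefinite** (`0 ≤ β ≤ 1`).
On `A_{p^m} = ℚ[ℤ/p^m ℤ]` the Hermitian form `⟨x, y⟩_β = φ_β(x* y)` of the Bost–Connes KMS_β
state ([ConnesMarcolli2008] Thm. 3.32, values (3.138)) has positive semidefinite Gram matrix
`G_β[i, j] = φ_β(e((j-i)/p^m))`. Proof (the finite-level mechanism of "`φ_β` is a state"):
with `w(e) = φ_β` at order `p^e` (decreasing in `e` for `0 ≤ β ≤ 1`) and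
`A_0 = w(m)`, `A_i = w(m-i) - w(m-i+1) ≥ 0`, one has
`G_β = ∑_{i=0}^{m} A_i · B_iᵀ B_i`, where `B_iᵀ B_i` is the indicator of the relation
`p^{m-i}(y - x) = 0` (same coset of `p^i ℤ/p^m ℤ`), because `φ_β(e(γ))` with `ord γ = p^e`
equals `∑_{i ≤ m-e} A_i = w(e)`. [cite: ConnesMarcolli2008, Ch. 3 Thm. 3.32, eq. (3.138)] -/
theorem posSemidef_kmsGram_primePow (m : ℕ) {β : ℝ} (h0 : 0 ≤ β) (h1 : β ≤ 1) :
    (kmsGram β (p ^ m)).PosSemidef := by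
  -- the telescoping coefficients
  set w : ℕ → ℝ := fun e => kmsValue β (p ^ e) with hw
  set g : ℕ → ℝ := fun v => w (m - v) with hg
  set A : ℕ → ℝ := fun i => if i = 0 then g 0 else g i - g (i - 1) with hA
  have hA_nonneg : ∀ i, 0 ≤ A i := by
    intro i
    simp only [hA]
    split_ifs with hi
    · exact kmsValue_primePow_nonneg h1 _
    · simp only [hg, hw]
      rcases Nat.lt_or_ge m i with hmi | hmi
      · rw [Nat.sub_eq_zero_of_le hmi.le, Nat.sub_eq_zero_of_le (by omega), sub_self]
      · rw [show m - (i - 1) = (m - i) + 1 by omega]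
        exact sub_nonneg.2 (kmsValue_primePow_succ_le h0 h1 _)
  have hsumA : ∀ v, ∑ i ∈ Finset.range (v + 1), A i = g v := by
    intro v
    induction v with
    | zero => simp [hA]
    | succ v ih =>
      rw [Finset.sum_range_succ, ih]
      simp only [hA, Nat.succ_ne_zero, if_false, Nat.add_sub_cancel]
      ring
  -- the decomposition of the Gram matrix
  have key : kmsGram β (p ^ m) =
      ∑ i ∈ Finset.range (m + 1),
        A i • ((cosetMatrix (p := p) m i)ᴴ * cosetMatrix (p := p) m i) := by
    ext x y
    rw [kmsGram_apply, Matrix.sum_apply]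
    simp only [Matrix.smul_apply, conjTranspose_cosetMatrix_mul_self_apply, smul_eq_mul,
      mul_ite, mul_one, mul_zero]
    -- goal: kmsValue β (addOrderOf (y - x)) = ∑ i, if p^(m-i) • (y-x) = 0 then A i else 0
    obtain ⟨e, hem, he⟩ := exists_addOrderOf_eq_pow m (y - x)
    -- `p^(m-i) • (y - x) = 0 ↔ p^e ∣ p^(m-i) ↔ i ≤ m - e`
    have hiff : ∀ i ∈ Finset.range (m + 1),
        ((p ^ (m - i)) • (y - x) = 0 ↔ i < m - e + 1) := by
      intro i hi
      rw [Finset.mem_range] at hi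
      rw [← addOrderOf_dvd_iff_nsmul_eq_zero, he,
        Nat.pow_dvd_pow_iff_le_right hp.out.one_lt]
      omega
    rw [Finset.sum_congr rfl fun i hi => if_congr (hiff i hi) rfl rfl,
      ← Finset.sum_filter]
    have hfilter : (Finset.range (m + 1)).filter (fun i => i < m - e + 1) =
        Finset.range (m - e + 1) := by
      ext i
      simp only [Finset.mem_filter, Finset.mem_range]
      omega
    rw [hfilter, hsumA, hg, he]
    simp only [hw]
    rw [show m - (m - e) = e by omega]
  rw [key]
  exact Matrix.posSemidef_sum _ fun i _ =>
    (Matrix.posSemidef_conjTranspose_mul_self _).smul (hA_nonneg i)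

end PrimePow


/-! ## General levels: `G_β ≥ 0` on every `ℤ/nℤ`, `0 ≤ β ≤ 1`

The decomposition used for prime powers holds prime by prime: (3.138) is multiplicative in
the order `b`, `φ_β(e(γ)) = ∏_{p ∣ n} w_p(e_p(ord γ))`, each `p`-local factor is a non-negative
combination of the indicators `1[(n/p^i)(y - x) = 0]`, and the entrywise (Hadamard) product of
positive semidefinite matrices is positive semidefinite (Schur). -/

section General

/-- **(3.138) is multiplicative in the order**: for `b ≥ 1`,
`φ_β(e(a/b)) = ∏_{p ∣ b} (p^{e_p})^{-β} (1 - p^{β-1})/(1 - p^{-1}) = ∏_{p ∣ b} kmsValue β (p^{e_p})`,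
`b = ∏ p^{e_p}`. [cite: ConnesMarcolli2008, Ch. 3 Thm. 3.32, eq. (3.138)] -/
theorem kmsValue_eq_prod_primeFactors (β : ℝ) {b : ℕ} (hb : b ≠ 0) :
    kmsValue β b = ∏ p ∈ b.primeFactors, kmsValue β (p ^ b.factorization p) := by
  have hfac : ∀ p ∈ b.primeFactors, kmsValue β (p ^ b.factorization p) =
      ((p : ℝ) ^ b.factorization p) ^ (-β) * ((1 - (p : ℝ) ^ (β - 1)) / (1 - (p : ℝ)⁻¹)) := by
    intro p hp
    haveI : Fact p.Prime := ⟨Nat.prime_of_mem_primeFactors hp⟩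
    have hne : b.factorization p ≠ 0 := by
      rw [← Finsupp.mem_support_iff, Nat.support_factorization]
      exact hp
    exact kmsValue_primePow β hne
  rw [Finset.prod_congr rfl hfac, Finset.prod_mul_distrib]
  unfold kmsValue
  congr 1
  rw [Real.finsetProd_rpow _ _ (fun p _ => pow_nonneg (Nat.cast_nonneg _) _)]
  congr 1
  have h := Nat.prod_factorization_pow_eq_self hb
  rw [Finsupp.prod, Nat.support_factorization] at h
  exact_mod_cast congrArg (Nat.cast : ℕ → ℝ) h.symm

variable (n : ℕ) [NeZero n]

/-- The `p`-local factor of the level-`n` Gram matrix: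
`F_p[x, y] = kmsValue β (p^{e_p(ord(y - x))})`. [cite: ConnesMarcolli2008, eq. (3.138)] -/
private def localGram (β : ℝ) (p : ℕ) : Matrix (ZMod n) (ZMod n) ℝ :=
  Matrix.of fun x y => kmsValue β (p ^ (addOrderOf (y - x)).factorization p)

/-- The level-`n` Gram matrix is the entrywise product of its `p`-local factors over the
primes `p ∣ n`. [cite: ConnesMarcolli2008, eq. (3.138)] -/
private theorem kmsGram_apply_eq_prod_localGram (β : ℝ) (x y : ZMod n) :
    kmsGram β n x y = ∏ p ∈ n.primeFactors, localGram n β p x y := by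
  have hn : n ≠ 0 := NeZero.ne n
  have hord0 : addOrderOf (y - x) ≠ 0 := (addOrderOf_pos _).ne'
  have hdvd : addOrderOf (y - x) ∣ n := by
    simpa [Nat.card_zmod] using addOrderOf_dvd_natCard (y - x)
  rw [kmsGram_apply, kmsValue_eq_prod_primeFactors β hord0]
  simp only [localGram, Matrix.of_apply]
  refine Finset.prod_subset (Nat.primeFactors_mono hdvd hn) fun p _ hp => ?_
  have h0 : (addOrderOf (y - x)).factorization p = 0 := by
    rwa [← Finsupp.notMem_support_iff, Nat.support_factorization]
  rw [h0, pow_zero, kmsValue_one]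

/-- "Same image under multiplication by `n/p^i`": `B[c, x] = 1[(n/p^i) x = c]`, so that
`(Bᵀ B)[x, y] = 1[(n/p^i)(y - x) = 0]`. [folklore] -/
private def imageMatrix (d : ℕ) : Matrix (ZMod n) (ZMod n) ℝ :=
  Matrix.of fun c x => if d • x = c then 1 else 0

/-- `(Bᵀ B)[x, y] = 1[d(y - x) = 0]`. [folklore] -/
private theorem conjTranspose_imageMatrix_mul_self_apply (d : ℕ) (x y : ZMod n) :
    ((imageMatrix n d)ᴴ * imageMatrix n d) x y = if d • (y - x) = 0 then 1 else 0 := by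
  rw [Matrix.mul_apply]
  simp only [Matrix.conjTranspose_apply, imageMatrix, Matrix.of_apply, star_trivial,
    ite_mul, one_mul, zero_mul]
  rw [Finset.sum_ite_eq]
  simp only [Finset.mem_univ, if_true, smul_sub, sub_eq_zero]

/-- For `d ∣ n` and `i ≤ m = e_p(n)`: `d ∣ n/p^i ↔ e_p(d) ≤ m - i`. [folklore] -/
private theorem dvd_div_pow_iff {p : ℕ} (hp : p.Prime) {d : ℕ} (hd : d ∣ n) {i : ℕ}
    (hi : i ≤ n.factorization p) :
    d ∣ n / p ^ i ↔ d.factorization p ≤ n.factorization p - i := by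
  have hn : n ≠ 0 := NeZero.ne n
  have hd0 : d ≠ 0 := fun h => hn (zero_dvd_iff.1 (h ▸ hd))
  have hpi : p ^ i ∣ n := (hp.pow_dvd_iff_le_factorization hn).2 hi
  have hq0 : n / p ^ i ≠ 0 := by
    intro h
    have := Nat.div_mul_cancel hpi
    rw [h, zero_mul] at this
    exact hn this.symm
  rw [← Nat.factorization_le_iff_dvd hd0 hq0, Nat.factorization_div hpi, hp.factorization_pow,
    Finsupp.le_def]
  have hdn : d.factorization ≤ n.factorization := (Nat.factorization_le_iff_dvd hd0 hn).2 hd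
  constructor
  · intro h
    simpa using h p
  · intro h q
    rw [Finsupp.tsub_apply, Finsupp.single_apply]
    by_cases hq : p = q
    · subst hq
      simpa using h
    · rw [if_neg hq, tsub_zero]
      exact hdn q

/-- Each `p`-local factor is positive semidefinite for `0 ≤ β ≤ 1` (same telescoping as in
the prime-power case, with the indicators `1[(n/p^i)(y - x) = 0]`, `0 ≤ i ≤ e_p(n)`).
[cite: ConnesMarcolli2008, Ch. 3 Thm. 3.32, eq. (3.138)] -/
private theorem posSemidef_localGram {β : ℝ} (h0 : 0 ≤ β) (h1 : β ≤ 1) {p : ℕ}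
    (hp : p ∈ n.primeFactors) : (localGram n β p).PosSemidef := by
  haveI : Fact p.Prime := ⟨Nat.prime_of_mem_primeFactors hp⟩
  have hn : n ≠ 0 := NeZero.ne n
  set m := n.factorization p with hm
  set w : ℕ → ℝ := fun e => kmsValue β (p ^ e) with hw
  set g : ℕ → ℝ := fun v => w (m - v) with hg
  set A : ℕ → ℝ := fun i => if i = 0 then g 0 else g i - g (i - 1) with hA
  have hA_nonneg : ∀ i, 0 ≤ A i := by
    intro i
    simp only [hA]
    split_ifs with hi
    · exact kmsValue_primePow_nonneg h1 _
    · simp only [hg, hw]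
      rcases Nat.lt_or_ge m i with hmi | hmi
      · rw [Nat.sub_eq_zero_of_le hmi.le, Nat.sub_eq_zero_of_le (by omega), sub_self]
      · rw [show m - (i - 1) = (m - i) + 1 by omega]
        exact sub_nonneg.2 (kmsValue_primePow_succ_le h0 h1 _)
  have hsumA : ∀ v, ∑ i ∈ Finset.range (v + 1), A i = g v := by
    intro v
    induction v with
    | zero => simp [hA]
    | succ v ih =>
      rw [Finset.sum_range_succ, ih]
      simp only [hA, Nat.succ_ne_zero, if_false, Nat.add_sub_cancel]
      ring
  have key : localGram n β p =
      ∑ i ∈ Finset.range (m + 1),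
        A i • ((imageMatrix n (n / p ^ i))ᴴ * imageMatrix n (n / p ^ i)) := by
    ext x y
    rw [Matrix.sum_apply]
    simp only [localGram, Matrix.of_apply, Matrix.smul_apply,
      conjTranspose_imageMatrix_mul_self_apply, smul_eq_mul, mul_ite, mul_one, mul_zero]
    have hdvd : addOrderOf (y - x) ∣ n := by
      simpa [Nat.card_zmod] using addOrderOf_dvd_natCard (y - x)
    set e := (addOrderOf (y - x)).factorization p with he
    have hem : e ≤ m := by
      have := (Nat.factorization_le_iff_dvd (addOrderOf_pos _).ne' hn).2 hdvd
      exact this p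
    have hiff : ∀ i ∈ Finset.range (m + 1),
        ((n / p ^ i) • (y - x) = 0 ↔ i < m - e + 1) := by
      intro i hi
      rw [Finset.mem_range] at hi
      rw [← addOrderOf_dvd_iff_nsmul_eq_zero,
        dvd_div_pow_iff n (Nat.prime_of_mem_primeFactors hp) hdvd (by omega)]
      omega
    rw [Finset.sum_congr rfl fun i hi => if_congr (hiff i hi) rfl rfl,
      ← Finset.sum_filter]
    have hfilter : (Finset.range (m + 1)).filter (fun i => i < m - e + 1) =
        Finset.range (m - e + 1) := by
      ext i
      simp only [Finset.mem_filter, Finset.mem_range]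
      omega
    rw [hfilter, hsumA, hg]
    simp only [hw]
    rw [show m - (m - e) = e by omega]
  rw [key]
  exact Matrix.posSemidef_sum _ fun i _ =>
    (Matrix.posSemidef_conjTranspose_mul_self _).smul (hA_nonneg i)

/-- The all-ones matrix is positive semidefinite (`= vᵀ v` for the all-ones row `v`). [folklore] -/
private theorem posSemidef_of_one : (Matrix.of fun (_ : ZMod n) (_ : ZMod n) => (1 : ℝ)).PosSemidef := by
  have h : (Matrix.of fun (_ : ZMod n) (_ : ZMod n) => (1 : ℝ)) =
      (Matrix.of fun (_ : Unit) (_ : ZMod n) => (1 : ℝ))ᴴ *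
        Matrix.of fun (_ : Unit) (_ : ZMod n) => (1 : ℝ) := by
    ext x y
    simp [Matrix.mul_apply]
  rw [h]
  exact Matrix.posSemidef_conjTranspose_mul_self _

/-- Entrywise products over a finset of positive semidefinite real matrices are positive
semidefinite (Schur product theorem, iterated). [folklore] -/
private theorem posSemidef_finsetProd {ι : Type*} [DecidableEq ι] (s : Finset ι)
    (F : ι → Matrix (ZMod n) (ZMod n) ℝ) (hF : ∀ i ∈ s, (F i).PosSemidef) :
    (Matrix.of fun x y => ∏ i ∈ s, F i x y).PosSemidef := by
  induction s using Finset.induction_on with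
  | empty => simpa using posSemidef_of_one n
  | insert a s ha ih =>
    have heq : (Matrix.of fun x y => ∏ i ∈ insert a s, F i x y) =
        F a ⊙ Matrix.of fun x y => ∏ i ∈ s, F i x y := by
      ext x y
      simp [Finset.prod_insert ha, Matrix.hadamard_apply]
    rw [heq]
    exact (hF a (Finset.mem_insert_self a s)).hadamard
      (ih fun i hi => hF i (Finset.mem_insert_of_mem hi))

/-- **The KMS_β Gram form is positive semidefinite on every finite level** (`n ≥ 1`,
`0 ≤ β ≤ 1`): the Hermitian form `⟨x, y⟩_β = φ_β(x* y)` induced on `A_n = ℚ[ℤ/nℤ]` by the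
Bost–Connes KMS_β state ([ConnesMarcolli2008] Thm. 3.32, values (3.138)) has positive
semidefinite Gram matrix `G_β[i,j] = φ_β(e((j-i)/n))` — the finite-level content of
"`φ_β` is a state" on `ℂ[ℚ/ℤ] = lim ℂ[ℤ/nℤ]`. Mechanism: `G_β` is the entrywise product over
`p ∣ n` of the `p`-local factors (multiplicativity of (3.138)), each a non-negative combination
of subgroup-coset indicator Grams (`0 ≤ β ≤ 1`), and Schur's product theorem.
[cite: ConnesMarcolli2008, Ch. 3 Thm. 3.32, eq. (3.138)] -/
theorem posSemidef_kmsGram {β : ℝ} (h0 : 0 ≤ β) (h1 : β ≤ 1) :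
    (kmsGram β n).PosSemidef := by
  classical
  have heq : kmsGram β n = Matrix.of fun x y => ∏ p ∈ n.primeFactors, localGram n β p x y := by
    ext x y
    rw [kmsGram_apply_eq_prod_localGram, Matrix.of_apply]
  rw [heq]
  exact posSemidef_finsetProd n _ _ fun p hp => posSemidef_localGram n h0 h1 hp

end General

end Literature.NumberTheory.BostConnes
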